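import Summits.AnomalousDissipation.AnomalousDissipation.Theses.TaylorCertificates
import Summits.AnomalousDissipation.AnomalousDissipation.Theorems.TaylorCertificatesForcedStandingFlowsLimit
import Summits.AnomalousDissipation.AnomalousDissipation.Theorems.TaylorCertificatesForcedStandingFlowsSubsolution
import Literature.Analysis.FluidPDE.StationaryEulerLaminatesHighDim
import HarnessLib

/-!
# Route TaylorCertificates — the support `ForcedStandingFlows` (item stmt-AnomalousDissipation-14031)

Proof of the route declaration
`Summit.AnomalousDissipation.AnomalousDissipation.Theses.TaylorCertificates.ForcedStandingFlows`:
the forced stationary Euler `h`-principle on `T³` in the minimal form the phantom law needs — for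
EVERY smooth divergence-free mean-zero force `f` a bounded (`MemLp ⊤`), weakly divergence-free,
mean-zero weak stationary Euler flow `v` driven by `f`,
`∫ ⟪v, (v·∇)w⟫ + ⟪f, w⟫ = 0` for all smooth divergence-free `w`, with non-negative work
`0 ≤ ∫ ⟪f, v⟫`.

Proof (Choffrut–Székelyhidi 2014, Thm. 1, run from an affine subsolution): the tree proves the
unforced theorem by an explicit convex-integration iteration (`Literature.Analysis.FluidPDE.StationaryEuler.*`);
the companion files `TaylorCertificatesForcedStandingFlows{Step,Iteration,Limit,Subsolution}`
re-run that iteration from the smooth strict affine subsolution `w_f = (f, ℛf)` of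
`div v = 0`, `div u + ∇q = f` in `int 𝒦_E^{co}` (`d = 3`, constant `E`), with the extra test
field `(f, 0)` and tolerance `θ ≤ ‖f‖₂²/2`. The limit `(v, u)` lies in `𝒦_E` a.e., so
`∫ ⟪v, (v·∇)w⟫ = ∫ u : ∇w = ∫ ℛf : ∇w = -∫ ⟪f, w⟫`; its velocity identity and means are those
of `f` (weakly divergence free, mean zero); and `∫ ⟪f, v⟫ ≥ ‖f‖₂² - θ > 0` unless `f = 0` a.e.

## References

* A. Choffrut, L. Székelyhidi Jr., *Weak solutions to the stationary incompressible Euler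
  equations*, SIAM J. Math. Anal. 46 (2014) 4060–4074 = arXiv:1401.4301, Thm. 1, §2.
* C. De Lellis, L. Székelyhidi Jr., Arch. Ration. Mech. Anal. 195 (2010) (subsolutions, `𝒦^{co}`).
-/

noncomputable section

open scoped InnerProductSpace ContDiff ENNReal Topology Matrix
open Set Function MeasureTheory Metric Filter
open Literature.Analysis.FunctionSpaces Literature.Analysis.FluidPDE
open Literature.Analysis.FluidPDE.StationaryEuler

namespace Summit.AnomalousDissipation.AnomalousDissipation.Theorems

-- the mandated namespace `Summit.<Summit>.<Problem>.Theorems` repeats `AnomalousDissipation` (single-problem summit)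
set_option linter.dupNamespace false

namespace ForcedFlows

/-! ## The forced standing flows -/

/-- **Forced standing flows** (the forced stationary Euler `h`-principle on `T³`, in the form the
route needs): for every smooth divergence-free mean-zero force `f` there is a bounded, weakly
divergence-free, mean-zero weak stationary Euler flow driven by `f`,
`∫ ⟪v, (v·∇)w⟫ + ⟪f, w⟫ = 0` for all smooth divergence-free `w`, on which the force does
non-negative work, `0 ≤ ∫ ⟪f, v⟫`. Proof: the Choffrut–Székelyhidi iteration (tree:
`StationaryEuler.*`, here `ForcedFlows.FIterData`) in `int 𝒦_E^{co}` (`d = 3`) started from the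
affine strict subsolution `(f, ℛf)` with the extra test field `(f, 0)` and tolerance
`θ ≤ ‖f‖₂²/2`; the limit `(v, u)` lies in `𝒦_E` a.e., so `∫ ⟪v, (v·∇)w⟫ = ∫ u : ∇w = ∫ ℛf : ∇w
= -∫ ⟪f, w⟫`, its velocity identities and means are those of `f`, and
`∫ ⟪f, v⟫ ≥ ‖f‖₂² - θ > 0` (or `f = 0` a.e.). [cite: ChoffrutSzekelyhidi2014, Thm. 1] -/
theorem forcedStandingFlows :
    Summit.AnomalousDissipation.AnomalousDissipation.Theses.TaylorCertificates.ForcedStandingFlows := by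
  intro f hf hdiv hmean
  have hd3 : 3 ≤ Fintype.card (Fin 3) := by simp
  have hd2 : 2 ≤ Fintype.card (Fin 3) := by simp
  obtain ⟨E, -, hEU⟩ := exists_forall_mem_highDimU (isSmooth_forcedState hf).continuous (isAdm_forcedState hd2 hf)
  obtain ⟨θ, hθ, hθA⟩ : ∃ θ : ℝ, 0 < θ ∧ (0 < ∫ x, ‖f x‖ ^ 2 → 2 * θ ≤ ∫ x, ‖f x‖ ^ 2) := by
    by_cases hA : 0 < ∫ x, ‖f x‖ ^ 2
    · exact ⟨(∫ x, ‖f x‖ ^ 2) / 2, by positivity, fun _ => by linarith⟩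
    · exact ⟨1, one_pos, fun h => absurd h hA⟩
  let D : FIterData (Fin 3) :=
    { 𝓕 := HighDim.relaxedFamily hd3, e := fun _ => E, w₀ := forcedState f, q := velState f, θ := θ,
      he := continuous_const, hw₀ := isSmooth_forcedState hf, hw₀U := hEU,
      hq := (isSmooth_velState hf).continuous, hθ := hθ }
  have hw₀ : D.w₀ = forcedState f := rfl
  have hq : D.q = velState f := rfl
  have he : ∀ x, D.e x = E := fun _ => rfl
  set v : UnitAddTorus (Fin 3) → Ed (Fin 3) := fun x => vel (D.wlim x) with hvdef
  have hvm : AEStronglyMeasurable v volume := continuous_vel.comp_aestronglyMeasurable D.aestronglyMeasurable_wlim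
  have hvb : ∀ᵐ x, ‖v x‖ ≤ D.R := by
    filter_upwards [D.ae_norm_wlim_le] with x hx using (norm_vel_le _).trans hx
  refine ⟨v, memLp_top_of_bound hvm D.R hvb, fun θ' hθ' => ?_, ?_, fun Φ hΦ hΦdiv => ?_, ?_⟩
  · -- weakly divergence free: the velocity identity of the limit is that of `f`
    have h1 : ∀ x, ⟪v x, Torus.gradient θ' x⟫_ℝ = ∑ i, vel (D.wlim x) i * Torus.partialDeriv i θ' x := fun x => by
      rw [real_inner_comm, Torus.inner_gradient_left, Torus.fderiv_apply_eq_sum_partialDeriv (hθ'.isContDiff (by simp))]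
      simp only [smul_eq_mul, hvdef]
    have h2 : ∀ x, ∑ i, vel (D.w₀ x) i * Torus.partialDeriv i θ' x = ⟪f x, Torus.gradient θ' x⟫_ℝ := fun x => by
      rw [real_inner_comm, Torus.inner_gradient_left, Torus.fderiv_apply_eq_sum_partialDeriv (hθ'.isContDiff (by simp)),
        hw₀, vel_forcedState]
      simp only [smul_eq_mul]
    simp_rw [h1]
    rw [D.wlim_weak_vel hθ']
    simp_rw [h2]
    rw [Torus.integral_inner_gradient_eq_neg_integral_mul_divergence_holds hf hθ']
    simp [hdiv _]
  · -- zero mean: the coordinate means of the limit are those of `f`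
    show ∫ x, v x = 0
    have hvi : Integrable v volume := D.integrable_vel_wlim
    ext i
    rw [eval_integral_piLp (fun j => hvi.eval_piLp j) i]
    have h1 : (fun x => v x i) = fun x => D.wlim x (Sum.inl i) := funext fun x => by simp only [hvdef, vel_apply]
    have h2 : (fun x => D.w₀ x (Sum.inl i)) = fun x => f x i := funext fun x => by
      rw [hw₀, ← vel_apply (forcedState f x) i, vel_forcedState]
    rw [h1, D.integral_wlim_apply (Sum.inl i), h2, ← eval_integral_piLp (fun j => (hf.apply j).integrable) i]
    have hm : ∫ x, f x = 0 := hmean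
    rw [hm, PiLp.zero_apply]
  · -- the forced weak Euler identity
    have hpt : ∀ x, ⟪v x, Torus.convect v Φ x⟫_ℝ = ∑ i, ∑ j, v x i * v x j * Torus.partialDeriv j (fun y => Φ y i) x := by
      intro x
      rw [Torus.convect, PiLp.inner_apply]
      refine Finset.sum_congr rfl fun i _ => ?_
      simp only [RCLike.inner_apply, conj_trivial, fderiv_apply_apply hΦ, Finset.sum_mul]
      refine Finset.sum_congr rfl fun j _ => ?_
      ring
    set S : UnitAddTorus (Fin 3) → ℝ := fun x => ∑ i, ∑ j, str (D.wlim x) i j * Torus.partialDeriv j (fun y => Φ y i) x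
      with hS
    have hae : (fun x => ⟪v x, Torus.convect v Φ x⟫_ℝ) =ᵐ[volume] S := by
      filter_upwards [D.ae_wlim_mem_K] with x hx
      rw [hpt, hS]
      have hstr : ∀ i j, str (D.wlim x) i j = v x i * v x j - if i = j then D.e x / Fintype.card (Fin 3) else 0 := by
        intro i j
        rw [hx.2, Matrix.sub_apply, Matrix.smul_apply, Matrix.one_apply]
        simp [tensorSelf, Matrix.vecMulVec_apply, hvdef]
      have hdivx : ∑ i, Torus.partialDeriv i (fun y => Φ y i) x = 0 := hΦdiv x
      simp_rw [hstr, sub_mul, Finset.sum_sub_distrib]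
      have htr : ∑ i, ∑ j, (if i = j then D.e x / Fintype.card (Fin 3) else 0) * Torus.partialDeriv j (fun y => Φ y i) x = 0 := by
        simp_rw [ite_mul, zero_mul, Finset.sum_ite_eq, Finset.mem_univ, if_true, ← Finset.mul_sum, hdivx, mul_zero]
      rw [htr, sub_zero]
    have hSi : Integrable S volume := by
      have := D.integrable_sum_coord_mul (fun ij : Fin 3 × Fin 3 => Sum.inr ij)
        (fun ij => Torus.partialDeriv ij.2 (fun y => Φ y ij.1)) fun ij => ((hΦ.apply ij.1).partialDeriv ij.2).continuous
      simpa only [hS, str_apply, Fintype.sum_prod_type] using this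
    have hfi : Integrable (fun x => ⟪f x, Φ x⟫_ℝ) volume := (hf.inner hΦ).integrable
    have hSval : ∫ x, S x = -∫ x, ⟪f x, Φ x⟫_ℝ := by
      rw [hS, D.wlim_weak_str hΦ hΦdiv, hw₀, integral_str_forcedState hd2 hf hΦ]
      have hm : ∫ x, f x = 0 := hmean
      rw [hm]
      congr 1
      refine integral_congr_ae (Eventually.of_forall fun x => ?_)
      simp only [PiLp.zero_apply, sub_zero, PiLp.inner_apply, RCLike.inner_apply, conj_trivial]
      exact Finset.sum_congr rfl fun i _ => mul_comm _ _
    have hae' : (fun x => ⟪v x, Torus.convect v Φ x⟫_ℝ + ⟪f x, Φ x⟫_ℝ) =ᵐ[volume] fun x => S x + ⟪f x, Φ x⟫_ℝ := by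
      filter_upwards [hae] with x hx
      rw [hx]
    rw [integral_congr_ae hae', integral_add hSi hfi, hSval]
    ring
  · -- non-negative work
    have hpair : ∀ x, ⟪f x, v x⟫_ℝ = ⟪D.wlim x, D.q x⟫_ℝ := fun x => by
      rw [hq, inner_velState, hvdef, real_inner_comm]
    have hw₀q : ∫ x, ⟪D.w₀ x, D.q x⟫_ℝ = ∫ x, ‖f x‖ ^ 2 := by
      refine integral_congr_ae (Eventually.of_forall fun x => ?_)
      simp only [hq, hw₀, inner_velState, vel_forcedState, real_inner_self_eq_norm_sq]
    have hbd := D.abs_integral_inner_wlim_q_sub_le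
    rw [hw₀q] at hbd
    simp_rw [hpair]
    by_cases hA : 0 < ∫ x, ‖f x‖ ^ 2
    · have h2 := hθA hA
      have h3 := (abs_le.1 hbd).1
      change -θ ≤ (∫ x, ⟪D.wlim x, D.q x⟫_ℝ) - ∫ x, ‖f x‖ ^ 2 at h3
      linarith
    · -- `f = 0` a.e.
      have hint : Integrable (fun x => ‖f x‖ ^ 2) volume := hf.norm_sq.integrable
      have h0 : ∫ x, ‖f x‖ ^ 2 = 0 := le_antisymm (not_lt.1 hA) (integral_nonneg fun x => by positivity)
      have hae := (integral_eq_zero_iff_of_nonneg (fun x => by positivity) hint).1 h0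
      have hzero : (fun x => ⟪D.wlim x, D.q x⟫_ℝ) =ᵐ[volume] fun _ => 0 := by
        filter_upwards [hae] with x hx
        have hfx : f x = 0 := by simpa using hx
        rw [hq, inner_velState, hfx, inner_zero_right]
      rw [integral_congr_ae hzero, integral_zero]

end ForcedFlows

/-- The route declaration `ForcedStandingFlows`, proved (item stmt-AnomalousDissipation-14031).
[cite: ChoffrutSzekelyhidi2014, Thm. 1] -/
theorem ForcedStandingFlows_proof :
    Summit.AnomalousDissipation.AnomalousDissipation.Theses.TaylorCertificates.ForcedStandingFlows :=
  ForcedFlows.forcedStandingFlows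

end Summit.AnomalousDissipation.AnomalousDissipation.Theorems
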